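import Summits.CriticalPhenomena.SAWScalingLimit.Theses.SAWQuarterTwist

/-!
# Line `birth` — registered skeleton for the crux `BulkToBoundary` (stmt-CriticalPhenomena-16652)

Crux (FIXED; rank 4 of `route-CriticalPhenomena-SAWQuarterTwist`, sub-problem `SAWScalingLimit`):

  `BulkToBoundary : TwistedPropagatorLaw → BulkScalingLimitExists → HexObservableLimitR`

— the whole-plane quarter-twisted propagator law (P) and the existence of the bulk-sourced scaling
limit (B) imply Duminil-Copin–Smirnov Conjecture 2 in the repaired, flat-pinned, test-function form
`HexObservableLimitR` (shared target stmt-CriticalPhenomena-14003): for every flat-pinned Dobrushin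
set-up, the `b`-normalised boundary-source observable `δ² Σ_e ψ(δ·mid e) F_δ(e) / F_δ(b_δ)` tends, as
`δ → 0⁺`, to `c ∫ ψ exp((5/8)(L − L_b))` with ONE universal `c ≠ 0`.

## The cut — compactness / identification, each fed by one bulk input (the route's own two-layer plan
`SourceToBoundaryContinuity → RHUniqueness → BulkToBoundary`)

Every observable-convergence theorem of the Smirnov / Duminil-Copin–Smirnov / Kemppainen–Smirnov type
is proved in two halves, and the crux text names them: "move the source to the boundary … (the fusion is
regular)" and "identify the boundary limit by uniqueness of the σ = 5/8 Riemann–Hilbert problem in the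
limit class". Typed over the crux's own data (the flat-pinned admissible families of
`HexObservableLimitR`, split into the LATTICE side `AdmissibleFamily` and the CONFORMAL side
`ConformalData`, and the `b`-normalised tested observable `normObs`, all verbatim):

* S1 `stub_sourceToBoundary` — **source-to-boundary fusion = precompactness with analytic
  subsequential limits** (`BoundaryPrecompact`): given (P) and (B), for every flat-pinned admissible
  family and every sequence of meshes `u n → 0⁺` there are a subsequence `φ` and a function `g`
  HOLOMORPHIC on `Ω` with `normObs ψ (u (φ n)) → ∫ ψ g` for every bulk test function `ψ ∈ C_c(Ω)`.
  This is where the recorded why-might-fail of the crux lives ("continuity of the normalised family in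
  the SOURCE variable up to ∂Ω has no lattice equation behind it; an O(1) boundary layer at the root
  could renormalise the limit"): the bulk-sourced limits of (B) must be fused to the boundary root with
  uniform local bounds on the `b`-normalised family (h_ψ = h_(1,2) = 5/8, regular fusion), and
  holomorphy of subsequential limits comes from the DCS vertex relation (Morera in the mean).
  It uses NO conformal data (precompactness is a statement about the lattice family alone).
* S2 `stub_rhUniqueness` — **Riemann–Hilbert uniqueness in the limit class**
  (`BoundaryIdentification`): given (P), there is ONE universal `c ≠ 0` such that for every flat-pinned
  admissible family, every conformal datum `(Φ, L, L_b)` of the crux, every mesh sequence `u n → 0⁺` and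
  every `g` holomorphic on `Ω` that IS the limit of the `b`-normalised family along `u` (against all
  bulk test functions), `g = c · exp((5/8)(L − L_b))` on `Ω`. The propagator law enters through the
  exponent of the root singularity (`g ∼ (z − a)^(−α)`, `α = 2σ = 5/4`, monodromy-quantised) that makes
  the σ = 5/8 Riemann–Hilbert problem (`g ∥ τ^(−5/8)` on ∂Ω, normalised at `b`) uniquely solvable; it
  also carries the NON-DEGENERACY of every subsequential limit (a limit `g ≡ 0` contradicts it), i.e.
  the universality of the `F(b_δ)`-normalisation in the flat-pinned class (the corridor witness of the
  refuted unpinned form stmt-5420 is excluded by the flat pinning, exactly as in the target).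

`BulkToBoundary_of` (kernel-checked, no `sorry` of its own) is the standard "compactness +
uniqueness of subsequential limits ⇒ convergence" argument, NOT a one-line seam: along `𝓝[>] 0`
(countably generated) a family converges iff every sequence `u n → 0⁺` has a subsequence along which it
converges to the SAME value (`Filter.tendsto_of_subseq_tendsto`); S1 supplies the subsequence and a
holomorphic `g`, S2 identifies `g`, and `∫ ψ g = c ∫ ψ exp((5/8)(L − L_b))` because `ψ` vanishes off
`tsupport ψ ⊆ Ω` (`image_eq_zero_of_notMem_tsupport`, `MeasureTheory.integral_const_mul`). It
concludes the route decl BY NAME (`hexObservableLimitR_of` proves the target `HexObservableLimitR` by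
name from the two named statements; the crux is the implication).

Neither stub alone gives the crux or the summit: S1 has no identification and no universal constant
(and no conformal data at all); S2 is conditional on the existence of a limit and says nothing where
none exists. Conversely each is a consequence-in-kind of the target (the target with conformal data
in hand gives S2 by uniqueness of weak limits + continuity, and S1 with `φ = id` once a conformal datum
exists — a Riemann-mapping/Carathéodory input not in the tree), so the pair is the honest two-sided
split of the conclusion, not a strengthening.

Disproof / negatives used: `ledger crux ls stmt-CriticalPhenomena-16652` — no workfiles (2026-08-17),
so there is no `Cruxes/BulkToBoundary/Disproof.lean`, no `_false_without_` obstruction to honour and no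
landed `Theorems/BulkToBoundary/Negative/*`. `ledger negatives --problem CriticalPhenomena`: the only
SAW-observable negative is stmt-5420 (`HexObservableLimit`, unpinned root, corridor witness
`SAWDefectDecoherenceHexObservableLimit_refuted`); both statements below quantify over EXACTLY the
flat-pinned admissible families of the repaired target `HexObservableLimitR` (hypotheses copied
verbatim), so the witness (a boundary-hugging corridor at the root, forbidden by the exact half-lattice
pinning in `B(pt i, ρ)`) is not an instance of either. Vacuity pass: `IsTest D ψ` is inhabited (bump
functions in the open carrier), limits in `ℂ` are unique, so the `g` of S2's hypothesis is determined
a.e. (hence everywhere, being continuous) by the family — S2 cannot be made inconsistent by two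
different `g`; S1's `∃ φ g` cannot be witnessed by junk (`g` must reproduce every `∫ ψ g` as an actual
limit); division by `F_δ(b_δ) = 0` gives the junk value `0` exactly as in the target (inherited
verbatim, `Nonempty (HexMidEdgeSAW …)` eventually as there).
-/

noncomputable section

-- the route file's scopes, re-opened verbatim so that elaboration (coercions, `∑ᶠ`, `𝓝[>]`) coincides
-- with the crux's and `hexObservableLimitR_of` can conclude the target after `dsimp only` (zeta on `let F`)
open scoped BigOperators Topology Manifold Classical MeasureTheory ProbabilityTheory Matrix InnerProductSpace ComplexConjugate ContinuousMap
open Filter Set Function TopologicalSpace MeasureTheory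
open Literature.Probability.RandomPlanarGeometry Literature.Probability.LatticeModels

namespace Summit.CriticalPhenomena.SAWScalingLimit.Cruxes.BulkToBoundary.Birth

/-! ### 1. Vocabulary — the target's data, verbatim -/

/-- The DCS boundary-source observable of the target at mesh `δ`:
`F_δ(z) = hexParafermionicObservable (Λ δ) (a δ) x_c (5/8) z` — VERBATIM the `let F` of
`HexObservableLimitR`. -/
def F (Λ : ℝ → Finset HexVertex) (a : ℝ → Sym2 HexVertex) (δ : ℝ) (z : Sym2 HexVertex) : ℂ :=
  Literature.Probability.RandomPlanarGeometry.SAW.hexParafermionicObservable (Λ δ) (a δ)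
    Literature.Probability.RandomPlanarGeometry.SAW.hexCriticalFugacity (5 / 8) z

/-- The `b`-normalised observable tested against `ψ` at mesh `δ`:
`δ² (Σ_{e ∈ midEdges(Λ δ)} ψ(δ · mid e) F_δ(e)) / F_δ(b δ)` — VERBATIM the sequence of the target. -/
def normObs (Λ : ℝ → Finset HexVertex) (a b : ℝ → Sym2 HexVertex) (ψ : ℂ → ℂ) (δ : ℝ) : ℂ :=
  (δ : ℂ) ^ 2 *
      (∑ᶠ e ∈ Literature.Probability.RandomPlanarGeometry.SAW.hexDomainMidEdges (Λ δ),
        ψ ((δ : ℂ) * Literature.Probability.RandomPlanarGeometry.SAW.hexMidpoint e) * F Λ a δ e) /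
    F Λ a δ (b δ)

/-- **The lattice side of a flat-pinned admissible family** — hypotheses 1–6 of the target, VERBATIM:
`ρ > 0`; both marked points `pt i` see a horizontal half-plane piece of `Ω` inside `B(pt i, ρ)`;
eventually in `δ → 0⁺` the discretisation `Λ δ` is simply connected, `a δ`, `b δ` are boundary
mid-edges joined by a SAW, `Λ δ` is connected, inside `Ω`, and is the EXACT half-lattice
`row ≥ m i δ` inside each `B(pt i, ρ)` (the pinning that excludes the corridor witness of stmt-5420);
compacts of `Ω` are exhausted; `δ · mid(a δ) → pt 0`, `δ · mid(b δ) → pt 1`. -/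
structure AdmissibleFamily (D : DobrushinDomain) (ρ : ℝ) (Λ : ℝ → Finset HexVertex)
    (m : Fin 2 → ℝ → ℤ) (a b : ℝ → Sym2 HexVertex) : Prop where
  pos : 0 < ρ
  flat : ∀ i : Fin 2, D.carrier ∩ Metric.ball (D.pt i) ρ =
    {z : ℂ | (D.pt i).im < z.im} ∩ Metric.ball (D.pt i) ρ
  lattice : ∀ᶠ δ : ℝ in nhdsWithin 0 (Set.Ioi 0),
    Literature.Probability.RandomPlanarGeometry.SAW.hexDomainSimplyConnected (Λ δ) ∧
      a δ ∈ Literature.Probability.RandomPlanarGeometry.SAW.hexDomainBoundary (Λ δ) ∧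
        b δ ∈ Literature.Probability.RandomPlanarGeometry.SAW.hexDomainBoundary (Λ δ) ∧
          Nonempty (Literature.Probability.RandomPlanarGeometry.SAW.HexMidEdgeSAW (Λ δ) (a δ) (b δ)) ∧
            (Literature.Probability.LatticeModels.hexGraph.induce
                ((Λ δ : Finset Literature.Probability.LatticeModels.HexVertex) :
                  Set Literature.Probability.LatticeModels.HexVertex)).Preconnected ∧
              (∀ v ∈ Λ δ, (δ : ℂ) * Literature.Probability.LatticeModels.hexCenter v ∈ D.carrier) ∧
                (∀ i : Fin 2, ∀ v : Literature.Probability.LatticeModels.HexVertex,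
                  (δ : ℂ) * Literature.Probability.LatticeModels.hexCenter v ∈ Metric.ball (D.pt i) ρ →
                    (v ∈ Λ δ ↔ m i δ ≤ v.1 1))
  exhaust : ∀ K : Set ℂ, IsCompact K → K ⊆ D.carrier → ∀ᶠ δ : ℝ in nhdsWithin 0 (Set.Ioi 0),
    ∀ v : Literature.Probability.LatticeModels.HexVertex,
      (δ : ℂ) * Literature.Probability.LatticeModels.hexCenter v ∈ K → v ∈ Λ δ
  tendsto_a : Filter.Tendsto
    (fun δ : ℝ => (δ : ℂ) * Literature.Probability.RandomPlanarGeometry.SAW.hexMidpoint (a δ))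
    (nhdsWithin 0 (Set.Ioi 0)) (nhds (D.pt 0))
  tendsto_b : Filter.Tendsto
    (fun δ : ℝ => (δ : ℂ) * Literature.Probability.RandomPlanarGeometry.SAW.hexMidpoint (b δ))
    (nhdsWithin 0 (Set.Ioi 0)) (nhds (D.pt 1))

/-- **The conformal side** — hypotheses 7–11 of the target, VERBATIM: `Φ : Ω ≃ ℍ` conformal with
`Φ → ∞` at `pt 0` (the root `a`) and `Φ → 0` at `pt 1` (the normalisation point `b`); `L` a
continuous logarithm of `Φ'` on `Ω` with boundary value `L_b` at `pt 1`. -/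
structure ConformalData (D : DobrushinDomain)
    (Φ : Literature.Probability.RandomPlanarGeometry.ConformalEquiv D.carrier
      UpperHalfPlane.upperHalfPlaneSet)
    (L : ℂ → ℂ) (Lb : ℂ) : Prop where
  atRoot : Filter.Tendsto (fun x => ‖Φ x‖) (nhdsWithin (D.pt 0) D.carrier) Filter.atTop
  atNorm : Φ.HasBoundaryValue (D.pt 1) 0
  log_cont : ContinuousOn L D.carrier
  log_exp : ∀ z ∈ D.carrier, Complex.exp (L z) = deriv Φ z
  log_lim : Filter.Tendsto L (nhdsWithin (D.pt 1) D.carrier) (nhds Lb)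

/-- A bulk test function of `Ω`: continuous, compactly supported, `tsupport ψ ⊆ Ω` — hypotheses
12–14 of the target, VERBATIM. -/
def IsTest (D : DobrushinDomain) (ψ : ℂ → ℂ) : Prop :=
  Continuous ψ ∧ HasCompactSupport ψ ∧ tsupport ψ ⊆ D.carrier

/-! ### 2. The two statements of the line, named -/

/-- **S1, named — precompactness of the `b`-normalised boundary family with HOLOMORPHIC
subsequential limits** (the source-to-boundary fusion): for every flat-pinned admissible family and
every mesh sequence `u n → 0⁺` there are a subsequence `φ` and `g` holomorphic on `Ω` with
`normObs ψ (u (φ n)) → ∫ ψ g` for every bulk test function `ψ`. No conformal data. -/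
def BoundaryPrecompact : Prop :=
  ∀ (D : DobrushinDomain) (ρ : ℝ) (Λ : ℝ → Finset HexVertex) (m : Fin 2 → ℝ → ℤ)
    (a b : ℝ → Sym2 HexVertex), AdmissibleFamily D ρ Λ m a b →
    ∀ u : ℕ → ℝ, Filter.Tendsto u Filter.atTop (nhdsWithin 0 (Set.Ioi 0)) →
      ∃ φ : ℕ → ℕ, StrictMono φ ∧ ∃ g : ℂ → ℂ, DifferentiableOn ℂ g D.carrier ∧
        ∀ ψ : ℂ → ℂ, IsTest D ψ →
          Filter.Tendsto (fun n => normObs Λ a b ψ (u (φ n))) Filter.atTop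
            (nhds (∫ z, ψ z * g z))

/-- **S2, named — Riemann–Hilbert uniqueness in the limit class** (identification of every
holomorphic subsequential limit, with ONE universal constant): `∃ c ≠ 0` such that for every
flat-pinned admissible family, every conformal datum, every mesh sequence `u n → 0⁺` and every `g`
holomorphic on `Ω` that is the limit of the `b`-normalised family along `u` against all bulk test
functions, `g = c · exp((5/8)(L − L_b))` on `Ω`. Includes the non-degeneracy of all such limits. -/
def BoundaryIdentification : Prop :=
  ∃ c : ℂ, c ≠ 0 ∧
    ∀ (D : DobrushinDomain) (ρ : ℝ) (Λ : ℝ → Finset HexVertex) (m : Fin 2 → ℝ → ℤ)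
      (a b : ℝ → Sym2 HexVertex)
      (Φ : Literature.Probability.RandomPlanarGeometry.ConformalEquiv D.carrier
        UpperHalfPlane.upperHalfPlaneSet)
      (L : ℂ → ℂ) (Lb : ℂ), AdmissibleFamily D ρ Λ m a b → ConformalData D Φ L Lb →
      ∀ u : ℕ → ℝ, Filter.Tendsto u Filter.atTop (nhdsWithin 0 (Set.Ioi 0)) →
        ∀ g : ℂ → ℂ, DifferentiableOn ℂ g D.carrier →
          (∀ ψ : ℂ → ℂ, IsTest D ψ →
            Filter.Tendsto (fun n => normObs Λ a b ψ (u n)) Filter.atTop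
              (nhds (∫ z, ψ z * g z))) →
          ∀ z ∈ D.carrier, g z = c * Complex.exp ((5 / 8 : ℂ) * (L z - Lb))

/-! ### 3. The registered stubs (the ONLY `sorry`s of this file) -/

/-- **S1 — source-to-boundary fusion** (HARDEST; size XL / the crux's recorded risk): the propagator
law (P) and the bulk scaling limit (B) give precompactness of the `b`-normalised boundary-source
family in the flat-pinned class, with holomorphic subsequential limits. Intended mechanism: the
boundary-source observable is the `a ∈ ∂Ω` member (`N ≡ 0`) of the exact quarter-twisted family; (B)
controls the normalised bulk-sourced currents on compacts, the fusion `p → a` is regular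
(`h_ψ = h_(1,2) = 5/8`), giving uniform local bounds ⇒ subsequential limits (Montel in the mean), and
the DCS vertex relation passes to the limit as Morera's condition ⇒ `g` holomorphic. -/
theorem stub_sourceToBoundary :
    Summit.CriticalPhenomena.SAWScalingLimit.Theses.SAWQuarterTwist.TwistedPropagatorLaw →
      Summit.CriticalPhenomena.SAWScalingLimit.Theses.SAWQuarterTwist.BulkScalingLimitExists →
        BoundaryPrecompact := by
  sorry

/-- **S2 — Riemann–Hilbert uniqueness in the limit class** (size L–XL): the propagator law (P) fixes
the root singularity exponent (`α = 2σ = 5/4`, `4α ∈ ℤ` by monodromy), with which the σ = 5/8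
Riemann–Hilbert problem on `Ω` (`g ∥ τ^(−5/8)` on `∂Ω` from the boundary winding of the DCS
observable, pole of order `α` at `a`, normalisation `1` at `b`) has the unique solution
`c · (Φ'/Φ'(b))^(5/8) = c · exp((5/8)(L − L_b))`, the constant `c ≠ 0` being universal in the
flat-pinned class (root and normalisation point both see exact horizontal half-lattices). -/
theorem stub_rhUniqueness :
    Summit.CriticalPhenomena.SAWScalingLimit.Theses.SAWQuarterTwist.TwistedPropagatorLaw →
      BoundaryIdentification := by
  sorry

/-! ### Consistency: each named statement IS its registered stub (definitionally) -/

theorem boundaryPrecompact_of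
    (hP : Summit.CriticalPhenomena.SAWScalingLimit.Theses.SAWQuarterTwist.TwistedPropagatorLaw)
    (hB : Summit.CriticalPhenomena.SAWScalingLimit.Theses.SAWQuarterTwist.BulkScalingLimitExists) :
    BoundaryPrecompact :=
  stub_sourceToBoundary hP hB

theorem boundaryIdentification_of
    (hP : Summit.CriticalPhenomena.SAWScalingLimit.Theses.SAWQuarterTwist.TwistedPropagatorLaw) :
    BoundaryIdentification :=
  stub_rhUniqueness hP

/-! ### Name-keyed aliases of the two stub statements — the hypotheses of `BulkToBoundary_of`

The skeleton audit (`#h21_check_skeleton`) admits a hypothesis of the skeleton theorem only if its head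
constant is a registered obligation or is NAMED like a declared stub; `__Registered.stub_X` is the
statement of `stub_X` under that name (device of `Cruxes/AsymptoticMorera/Lines/birth.lean`). Each alias
is `rfl`-equal to the type of its stub. -/
namespace __Registered

/-- Alias of the statement of `stub_sourceToBoundary`, keyed by the registered stub name. -/
abbrev stub_sourceToBoundary : Prop :=
  Summit.CriticalPhenomena.SAWScalingLimit.Theses.SAWQuarterTwist.TwistedPropagatorLaw →
    Summit.CriticalPhenomena.SAWScalingLimit.Theses.SAWQuarterTwist.BulkScalingLimitExists →
      BoundaryPrecompact

/-- Alias of the statement of `stub_rhUniqueness`, keyed by the registered stub name. -/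
abbrev stub_rhUniqueness : Prop :=
  Summit.CriticalPhenomena.SAWScalingLimit.Theses.SAWQuarterTwist.TwistedPropagatorLaw →
    BoundaryIdentification

end __Registered

/-! ### 4. The sorry-free part: compactness + uniqueness ⇒ the target, BY NAME -/

/-- Off the carrier a bulk test function vanishes, so an identity `g = h` on `Ω` gives
`∫ ψ g = ∫ ψ h`. -/
theorem integral_test_congr (D : DobrushinDomain) {ψ g h : ℂ → ℂ} (hψ : tsupport ψ ⊆ D.carrier)
    (hgh : ∀ z ∈ D.carrier, g z = h z) :
    ∫ z, ψ z * g z = ∫ z, ψ z * h z := by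
  congr 1
  funext z
  by_cases hz : z ∈ D.carrier
  · rw [hgh z hz]
  · have hψz : ψ z = 0 := image_eq_zero_of_notMem_tsupport fun h => hz (hψ h)
    simp [hψz]

/-- **The target from the two named statements** (no `sorry`): precompactness with holomorphic
subsequential limits (S1's conclusion) and Riemann–Hilbert identification (S2's conclusion) give
`HexObservableLimitR` BY NAME — `Filter.tendsto_of_subseq_tendsto` along the countably generated
`𝓝[>] 0`, the identified value being the same along every subsequence. -/
theorem hexObservableLimitR_of (h1 : BoundaryPrecompact) (h2 : BoundaryIdentification) :
    Summit.CriticalPhenomena.SAWScalingLimit.Theses.SAWQuarterTwist.HexObservableLimitR := by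
  obtain ⟨c, hc, H⟩ := h2
  refine ⟨c, hc, ?_⟩
  intro D ρ Λ m a b Φ L Lb ψ
  dsimp only
  intro hρ hflat hlat hK ha hb hΦ hΦb hL hexp hLb hψc hψs hψt
  have hA : AdmissibleFamily D ρ Λ m a b := ⟨hρ, hflat, hlat, hK, ha, hb⟩
  have hC : ConformalData D Φ L Lb := ⟨hΦ, hΦb, hL, hexp, hLb⟩
  refine Filter.tendsto_of_subseq_tendsto fun u hu => ?_
  obtain ⟨φ, hφ, g, hg, hlim⟩ := h1 D ρ Λ m a b hA u hu
  have hid : ∀ z ∈ D.carrier, g z = c * Complex.exp ((5 / 8 : ℂ) * (L z - Lb)) :=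
    H D ρ Λ m a b Φ L Lb hA hC (fun n => u (φ n)) (hu.comp hφ.tendsto_atTop) g hg
      (fun ψ' hψ' => hlim ψ' hψ')
  refine ⟨φ, ?_⟩
  have key : ∫ z, ψ z * g z = c * ∫ z, ψ z * Complex.exp ((5 / 8 : ℂ) * (L z - Lb)) := by
    rw [integral_test_congr D hψt hid, ← MeasureTheory.integral_const_mul]
    congr 1
    funext z
    ring
  have hT := hlim ψ ⟨hψc, hψs, hψt⟩
  rw [key] at hT
  simpa only [normObs, F] using hT

/-! ### 5. The skeleton theorem: the two stubs imply the crux, BY NAME -/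

/-- **`BulkToBoundary` from the line `birth`** (kernel-checked, no `sorry` of its own): hypotheses =
the two stubs under their registered names; conclusion = the route decl, by name. (P) feeds both
halves, (B) the fusion half. -/
theorem BulkToBoundary_of (h1 : __Registered.stub_sourceToBoundary)
    (h2 : __Registered.stub_rhUniqueness) :
    Summit.CriticalPhenomena.SAWScalingLimit.Theses.SAWQuarterTwist.BulkToBoundary :=
  fun hP hB => hexObservableLimitR_of (h1 hP hB) (h2 hP)

/-- Wiring check (an `example`, so that `BulkToBoundary_of` stays the only theorem concluding the
crux): the registered stubs, with their stated types, feed the skeleton theorem — this term becomes the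
crux proof when the two `sorry`s above are discharged. -/
example : Summit.CriticalPhenomena.SAWScalingLimit.Theses.SAWQuarterTwist.BulkToBoundary :=
  BulkToBoundary_of stub_sourceToBoundary stub_rhUniqueness

end Summit.CriticalPhenomena.SAWScalingLimit.Cruxes.BulkToBoundary.Birth

end
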